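import Mathlib.Data.Real.Basic
import Mathlib.Tactic.Linarith
import Mathlib.Tactic.Positivity
import Mathlib.Tactic.FieldSimp
import Mathlib.Tactic.Ring
import HarnessLib

/-!
# `NoHeavyLowerTail` (crux stmt-CriticalPhenomena-4575), P2 — THE `(2,2)` ATOM: PATTERN CERTIFICATES WITH POINT-DEPENDENT `H`
# AND THE REMAINDER BOUNDS AT THE FOUR CORNERS (pure real-number lemmas)

Seat `prim-masterthm-p2`, gen 29 (memo `FROM-prim-masterthm-p2-g29-SQUARE-IDENTITY.md` §8–§9; `--supports stmt-CriticalPhenomena-4575`).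
No `sorry`, no named facts, standard axioms; imports Mathlib only, so that it lands independently of the rest of the development.

CONTEXT.  The `(2,2)` atom of the crossed-positivity programme (memo §8) is the triple `f(z₁,z₂,a), g(z₁,z₂,b), h(z₁,z₂,a,b)` — the
first class with TWO coordinates essential to all three functions.  On the `(z₁,z₂)`-square with points `0=(0,0), Z=(1,0), C=(0,1),
T=(1,1)` (antipode `0 ↔ T`, `Z ↔ C`) every corner coefficient satisfies the box identity `I3_κ = Σ_b w_B S^ρ(b) + CP(ρ) + R_κ(ρ)` of
`…SahiHubTwoLevelSquare`, now with the fibre average `H_x(b) = Σ_a w_A h_x(a,b)` depending on the POINT `x` (monotone on the square) and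
`T_x = (2−ρ_x)Y_x − F_x̄H_x − (1−ρ_x̄)Y_x̄`.  The ratio rule is the gen-29 rule VERBATIM (`ρ_0 = 0`, `ρ_T = 1 − F_0/F_T`;
A1 `ρ_C = (F_C−F_Z)/F_T` [`G_Z ≥ G_C`, `F_Z ≤ F_C`], A2 `ρ_Z = 1−F_C/F_Z` [`G_Z ≥ G_C`, `F_Z > F_C`], B1 `ρ_C = (F_C−F_Z)/F_C`
[`G_Z < G_C`, `F_Z < F_C`], B2 `ρ_Z = (F_Z−F_C)/F_T` [`G_Z < G_C`, `F_Z ≥ F_C`]), plus the one-dimensional rule `(0, 1−F_0/F_Z)`,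
`(0, 1−F_0/F_C)` on the edges `{0,Z}`, `{0,C}` for the joint Bernstein coefficient `β₁₁` (memo §9).
THIS FILE proves, on abstract real data:
* `t2patT`, `t2patZCT_le/ge`, `t2patAll_le/ge`, `t2patZT_A1 … t2patCT_B2`: the five pattern sums as explicit nonnegative combinations of
  `Y_x ≥ F_xH_x`, `Y` monotone, `0 ≤ H_0 ≤ H_Z, H_C ≤ H_T` (the layer-cake `sq_core` of `…SquareRules` then gives `S^ρ ≥ 0`);
* `t2edge_hi`, `t2edge_both`: the two pattern sums of an edge `{lo, hi}` under the rule `(0, 1−F_lo/F_hi)`;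
* `t2R11_*`, `t2R10_*`, `t2R01_*`, `t2R00joint_*` (`* ∈ {A1,A2,B1,B2}`): the remainder bounds at the corners `(1,1),(1,0),(0,1)` and the
  JOINT bound `R_00 + R_edge{0,Z} + R_edge{0,C} ≥ 0`, from `Ȳ_x ≥ F_xH̄_x`, `Ȳ`, `H̄`, `G` monotone on the square.
(Every inequality chain was verified exactly on 1 328 cells / 34 864 instances, `code/gen29/finalcheck22.py`.) [this work]
-/


noncomputable section

namespace Summit.CriticalPhenomena.PercolationContinuityZ3.Theorems

namespace SahiT2Square

section Patterns

variable {F0 FZ FC FT Y0 YZ YC YT H0 HZ HC HT : ℝ}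

/-- Pattern `{T}` (all rules): `T_T = (1+F_0/F_T)Y_T − F_0H_T − Y_0 ≥ 0`. -/
theorem t2patT (hFT : 0 < FT) (hF0 : 0 ≤ F0) (sT : FT * HT ≤ YT) (mZ0 : Y0 ≤ YZ) (mTZ : YZ ≤ YT) :
    0 ≤ (2 - (1 - F0 / FT)) * YT - F0 * HT - (1 - 0) * Y0 := by
  have e : (2 - (1 - F0 / FT)) * YT - F0 * HT - (1 - 0) * Y0 = (YT - YZ) + (YZ - Y0) + F0 / FT * (YT - FT * HT) := by
    field_simp; ring
  rw [e]; have := mul_nonneg (div_nonneg hF0 hFT.le) (sub_nonneg.2 sT); linarith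

/-- Pattern `{Z,C,T}` (all rules; the `ρ_Z, ρ_C` terms cancel), case `F_Z ≤ F_C`. -/
theorem t2patZCT_le {ρZ ρC : ℝ} (hFT : 0 < FT) (hF0 : 0 ≤ F0) (hZC : FZ ≤ FC) (hCT : FC ≤ FT) (hZT : FZ ≤ FT)
    (hH0 : 0 ≤ H0) (hZ0 : H0 ≤ HZ) (hC0 : H0 ≤ HC) (hTZ : HZ ≤ HT)
    (sC : FC * HC ≤ YC) (sT : FT * HT ≤ YT) (mZ0 : Y0 ≤ YZ) :
    0 ≤ (2 - ρZ) * YZ - FC * HZ - (1 - ρC) * YC + ((2 - ρC) * YC - FZ * HC - (1 - ρZ) * YZ)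
      + ((2 - (1 - F0 / FT)) * YT - F0 * HT - (1 - 0) * Y0) := by
  have e : (2 - ρZ) * YZ - FC * HZ - (1 - ρC) * YC + ((2 - ρC) * YC - FZ * HC - (1 - ρZ) * YZ)
      + ((2 - (1 - F0 / FT)) * YT - F0 * HT - (1 - 0) * Y0) =
      (YC - FC * HC) + (1 + F0 / FT) * (YT - FT * HT) + (YZ - Y0) + (FC - FZ) * (HC - H0) + (FT - FC) * (HZ - H0)
        + (FT - FZ) * H0 + FT * (HT - HZ) := by
    field_simp; ring
  rw [e]
  have := mul_nonneg (show 0 ≤ 1 + F0 / FT by have := div_nonneg hF0 hFT.le; linarith) (sub_nonneg.2 sT)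
  have := mul_nonneg (sub_nonneg.2 hZC) (sub_nonneg.2 hC0); have := mul_nonneg (sub_nonneg.2 hCT) (sub_nonneg.2 hZ0)
  have := mul_nonneg (sub_nonneg.2 hZT) hH0; have := mul_nonneg hFT.le (sub_nonneg.2 hTZ)
  linarith

/-- Pattern `{Z,C,T}`, case `F_C ≤ F_Z` (mirror of `t2patZCT_le`). -/
theorem t2patZCT_ge {ρZ ρC : ℝ} (hFT : 0 < FT) (hF0 : 0 ≤ F0) (hCZ : FC ≤ FZ) (hZT : FZ ≤ FT) (hCT : FC ≤ FT)
    (hH0 : 0 ≤ H0) (hZ0 : H0 ≤ HZ) (hC0 : H0 ≤ HC) (hTC : HC ≤ HT)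
    (sZ : FZ * HZ ≤ YZ) (sT : FT * HT ≤ YT) (mC0 : Y0 ≤ YC) :
    0 ≤ (2 - ρZ) * YZ - FC * HZ - (1 - ρC) * YC + ((2 - ρC) * YC - FZ * HC - (1 - ρZ) * YZ)
      + ((2 - (1 - F0 / FT)) * YT - F0 * HT - (1 - 0) * Y0) := by
  have e : (2 - ρZ) * YZ - FC * HZ - (1 - ρC) * YC + ((2 - ρC) * YC - FZ * HC - (1 - ρZ) * YZ)
      + ((2 - (1 - F0 / FT)) * YT - F0 * HT - (1 - 0) * Y0) =
      (YZ - FZ * HZ) + (1 + F0 / FT) * (YT - FT * HT) + (YC - Y0) + (FZ - FC) * (HZ - H0) + (FT - FZ) * (HC - H0)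
        + (FT - FC) * H0 + FT * (HT - HC) := by
    field_simp; ring
  rw [e]
  have := mul_nonneg (show 0 ≤ 1 + F0 / FT by have := div_nonneg hF0 hFT.le; linarith) (sub_nonneg.2 sT)
  have := mul_nonneg (sub_nonneg.2 hCZ) (sub_nonneg.2 hZ0); have := mul_nonneg (sub_nonneg.2 hZT) (sub_nonneg.2 hC0)
  have := mul_nonneg (sub_nonneg.2 hCT) hH0; have := mul_nonneg hFT.le (sub_nonneg.2 hTC)
  linarith

/-- Pattern `all` (all rules; every `ρ` cancels), case `F_Z ≤ F_C`. -/
theorem t2patAll_le {ρZ ρC ρT : ℝ} (h0T : F0 ≤ FT) (hZC : FZ ≤ FC) (hgap : FC - FZ ≤ FT - F0)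
    (hZ0 : H0 ≤ HZ) (hC0 : H0 ≤ HC) (hTZ : HZ ≤ HT)
    (s0 : F0 * H0 ≤ Y0) (sZ : FZ * HZ ≤ YZ) (sC : FC * HC ≤ YC) (sT : FT * HT ≤ YT) :
    0 ≤ (2 - ρZ) * YZ - FC * HZ - (1 - ρC) * YC + ((2 - ρC) * YC - FZ * HC - (1 - ρZ) * YZ)
      + ((2 - ρT) * YT - F0 * HT - (1 - 0) * Y0) + ((2 - 0) * Y0 - FT * H0 - (1 - ρT) * YT) := by
  have := mul_nonneg (sub_nonneg.2 hZC) (sub_nonneg.2 hC0)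
  have := mul_nonneg (sub_nonneg.2 hgap) (sub_nonneg.2 hZ0); have := mul_nonneg (sub_nonneg.2 h0T) (sub_nonneg.2 hTZ)
  nlinarith

/-- Pattern `all`, case `F_C ≤ F_Z`. -/
theorem t2patAll_ge {ρZ ρC ρT : ℝ} (h0T : F0 ≤ FT) (hCZ : FC ≤ FZ) (hgap : FZ - FC ≤ FT - F0)
    (hZ0 : H0 ≤ HZ) (hC0 : H0 ≤ HC) (hTC : HC ≤ HT)
    (s0 : F0 * H0 ≤ Y0) (sZ : FZ * HZ ≤ YZ) (sC : FC * HC ≤ YC) (sT : FT * HT ≤ YT) :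
    0 ≤ (2 - ρZ) * YZ - FC * HZ - (1 - ρC) * YC + ((2 - ρC) * YC - FZ * HC - (1 - ρZ) * YZ)
      + ((2 - ρT) * YT - F0 * HT - (1 - 0) * Y0) + ((2 - 0) * Y0 - FT * H0 - (1 - ρT) * YT) := by
  have := mul_nonneg (sub_nonneg.2 hCZ) (sub_nonneg.2 hZ0)
  have := mul_nonneg (sub_nonneg.2 hgap) (sub_nonneg.2 hC0); have := mul_nonneg (sub_nonneg.2 h0T) (sub_nonneg.2 hTC)
  nlinarith

/-- Rule A1, pattern `{Z,T}`. -/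
theorem t2patZT_A1 (hFT : 0 < FT) (hF0 : 0 ≤ F0) (hZC : FZ ≤ FC) (hgap : FC - FZ ≤ FT) (hTZ : HZ ≤ HT)
    (sZ : FZ * HZ ≤ YZ) (sT : FT * HT ≤ YT) (mZ0 : Y0 ≤ YZ) (mTC : YC ≤ YT) :
    0 ≤ (2 - 0) * YZ - FC * HZ - (1 - (FC - FZ) / FT) * YC + ((2 - (1 - F0 / FT)) * YT - F0 * HT - (1 - 0) * Y0) := by
  have e : (2 - 0) * YZ - FC * HZ - (1 - (FC - FZ) / FT) * YC + ((2 - (1 - F0 / FT)) * YT - F0 * HT - (1 - 0) * Y0) =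
      (YZ - FZ * HZ) + (F0 + FC - FZ) / FT * (YT - FT * HT) + (YZ - Y0) + (1 - (FC - FZ) / FT) * (YT - YC)
        + (FC - FZ) * (HT - HZ) := by
    field_simp; ring
  rw [e]
  have c1 : 0 ≤ (F0 + FC - FZ) / FT := div_nonneg (by linarith) hFT.le
  have c2 : 0 ≤ 1 - (FC - FZ) / FT := by rw [sub_nonneg, div_le_one hFT]; exact hgap
  have := mul_nonneg c1 (sub_nonneg.2 sT); have := mul_nonneg c2 (sub_nonneg.2 mTC)
  have := mul_nonneg (sub_nonneg.2 hZC) (sub_nonneg.2 hTZ)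
  linarith

/-- Rule A1, pattern `{C,T}`. -/
theorem t2patCT_A1 (hFT : 0 < FT) (hF0 : 0 ≤ F0) (hZC : FZ ≤ FC) (hCT : FC ≤ FT) (hgap : FC - FZ ≤ FT) (hHC : 0 ≤ HC)
    (sC : FC * HC ≤ YC) (sT : FT * HT ≤ YT) (mC0 : Y0 ≤ YC) (mTZ : YZ ≤ YT) :
    0 ≤ (2 - (FC - FZ) / FT) * YC - FZ * HC - (1 - 0) * YZ + ((2 - (1 - F0 / FT)) * YT - F0 * HT - (1 - 0) * Y0) := by
  have e : (2 - (FC - FZ) / FT) * YC - FZ * HC - (1 - 0) * YZ + ((2 - (1 - F0 / FT)) * YT - F0 * HT - (1 - 0) * Y0) =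
      (1 - (FC - FZ) / FT) * (YC - FC * HC) + F0 / FT * (YT - FT * HT) + (YC - Y0) + (YT - YZ)
        + (FC - FZ) * (1 - FC / FT) * HC := by
    field_simp; ring
  rw [e]
  have c2 : 0 ≤ 1 - (FC - FZ) / FT := by rw [sub_nonneg, div_le_one hFT]; exact hgap
  have c3 : 0 ≤ 1 - FC / FT := by rw [sub_nonneg, div_le_one hFT]; exact hCT
  have := mul_nonneg c2 (sub_nonneg.2 sC); have := mul_nonneg (div_nonneg hF0 hFT.le) (sub_nonneg.2 sT)
  have := mul_nonneg (mul_nonneg (sub_nonneg.2 hZC) c3) hHC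
  linarith

/-- Rule A2, pattern `{Z,T}`. -/
theorem t2patZT_A2 (hFT : 0 < FT) (hFZ : 0 < FZ) (hF0 : 0 ≤ F0) (hC0 : 0 ≤ FC)
    (sZ : FZ * HZ ≤ YZ) (sT : FT * HT ≤ YT) (mZ0 : Y0 ≤ YZ) (mTC : YC ≤ YT) :
    0 ≤ (2 - (1 - FC / FZ)) * YZ - FC * HZ - (1 - 0) * YC + ((2 - (1 - F0 / FT)) * YT - F0 * HT - (1 - 0) * Y0) := by
  have e : (2 - (1 - FC / FZ)) * YZ - FC * HZ - (1 - 0) * YC + ((2 - (1 - F0 / FT)) * YT - F0 * HT - (1 - 0) * Y0) =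
      FC / FZ * (YZ - FZ * HZ) + F0 / FT * (YT - FT * HT) + (YZ - Y0) + (YT - YC) := by
    field_simp; ring
  rw [e]
  have := mul_nonneg (div_nonneg hC0 hFZ.le) (sub_nonneg.2 sZ); have := mul_nonneg (div_nonneg hF0 hFT.le) (sub_nonneg.2 sT)
  linarith

/-- Rule A2, pattern `{C,T}`. -/
theorem t2patCT_A2 (hFT : 0 < FT) (hFZ : 0 < FZ) (hF0 : 0 ≤ F0) (hC0 : 0 ≤ FC) (hCZ : FC ≤ FZ) (hZT : FZ ≤ FT)
    (hHT : 0 ≤ HT) (hTC : HC ≤ HT)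
    (sC : FC * HC ≤ YC) (sT : FT * HT ≤ YT) (mC0 : Y0 ≤ YC) (mTZ : YZ ≤ YT) :
    0 ≤ (2 - 0) * YC - FZ * HC - (1 - (1 - FC / FZ)) * YZ + ((2 - (1 - F0 / FT)) * YT - F0 * HT - (1 - 0) * Y0) := by
  have e : (2 - 0) * YC - FZ * HC - (1 - (1 - FC / FZ)) * YZ + ((2 - (1 - F0 / FT)) * YT - F0 * HT - (1 - 0) * Y0) =
      FC / FZ * (YT - YZ) + (YC - Y0) + F0 / FT * (YT - FT * HT) + (YC - FC * HC)
        + (1 - FC / FZ) * ((YT - FT * HT) + (FT - FZ) * HT + FZ * (HT - HC)) := by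
    field_simp; ring
  rw [e]
  have c1 : 0 ≤ 1 - FC / FZ := by rw [sub_nonneg, div_le_one hFZ]; exact hCZ
  have := mul_nonneg (div_nonneg hC0 hFZ.le) (sub_nonneg.2 mTZ); have := mul_nonneg (div_nonneg hF0 hFT.le) (sub_nonneg.2 sT)
  have i1 : 0 ≤ (YT - FT * HT) + (FT - FZ) * HT + FZ * (HT - HC) := by
    have := mul_nonneg (sub_nonneg.2 hZT) hHT; have := mul_nonneg hFZ.le (sub_nonneg.2 hTC); linarith
  have := mul_nonneg c1 i1
  linarith

/-- Rule B1, pattern `{C,T}`. -/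
theorem t2patCT_B1 (hFT : 0 < FT) (hFC : 0 < FC) (hF0 : 0 ≤ F0) (hZ0 : 0 ≤ FZ)
    (sC : FC * HC ≤ YC) (sT : FT * HT ≤ YT) (mC0 : Y0 ≤ YC) (mTZ : YZ ≤ YT) :
    0 ≤ (2 - (FC - FZ) / FC) * YC - FZ * HC - (1 - 0) * YZ + ((2 - (1 - F0 / FT)) * YT - F0 * HT - (1 - 0) * Y0) := by
  have e : (2 - (FC - FZ) / FC) * YC - FZ * HC - (1 - 0) * YZ + ((2 - (1 - F0 / FT)) * YT - F0 * HT - (1 - 0) * Y0) =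
      FZ / FC * (YC - FC * HC) + F0 / FT * (YT - FT * HT) + (YC - Y0) + (YT - YZ) := by
    field_simp; ring
  rw [e]
  have := mul_nonneg (div_nonneg hZ0 hFC.le) (sub_nonneg.2 sC); have := mul_nonneg (div_nonneg hF0 hFT.le) (sub_nonneg.2 sT)
  linarith

/-- Rule B1, pattern `{Z,T}`. -/
theorem t2patZT_B1 (hFT : 0 < FT) (hFC : 0 < FC) (hF0 : 0 ≤ F0) (hZ0 : 0 ≤ FZ) (hZC : FZ ≤ FC) (hCT : FC ≤ FT)
    (hHT : 0 ≤ HT) (hTZ : HZ ≤ HT)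
    (sZ : FZ * HZ ≤ YZ) (sT : FT * HT ≤ YT) (mZ0 : Y0 ≤ YZ) (mTC : YC ≤ YT) :
    0 ≤ (2 - 0) * YZ - FC * HZ - (1 - (FC - FZ) / FC) * YC + ((2 - (1 - F0 / FT)) * YT - F0 * HT - (1 - 0) * Y0) := by
  have e : (2 - 0) * YZ - FC * HZ - (1 - (FC - FZ) / FC) * YC + ((2 - (1 - F0 / FT)) * YT - F0 * HT - (1 - 0) * Y0) =
      (YZ - FZ * HZ) + (1 + F0 / FT - FZ / FC) * (YT - FT * HT) + (YZ - Y0) + FZ / FC * (YT - YC)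
        + (1 - FZ / FC) * ((FT - FC) * HT + FC * (HT - HZ)) := by
    field_simp; ring
  rw [e]
  have c1 : 0 ≤ 1 - FZ / FC := by rw [sub_nonneg, div_le_one hFC]; exact hZC
  have c2 : 0 ≤ 1 + F0 / FT - FZ / FC := by have := div_nonneg hF0 hFT.le; linarith
  have := mul_nonneg c2 (sub_nonneg.2 sT); have := mul_nonneg (div_nonneg hZ0 hFC.le) (sub_nonneg.2 mTC)
  have i1 : 0 ≤ (FT - FC) * HT + FC * (HT - HZ) := by
    have := mul_nonneg (sub_nonneg.2 hCT) hHT; have := mul_nonneg hFC.le (sub_nonneg.2 hTZ); linarith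
  have := mul_nonneg c1 i1
  linarith

/-- Rule B2, pattern `{Z,T}` (`F_Z > 0`). -/
theorem t2patZT_B2 (hFT : 0 < FT) (hFZ : 0 < FZ) (hF0 : 0 ≤ F0) (hC0 : 0 ≤ FC) (hCZ : FC ≤ FZ) (hZT : FZ ≤ FT)
    (hHZ : 0 ≤ HZ) (sZ : FZ * HZ ≤ YZ) (sT : FT * HT ≤ YT) (mZ0 : Y0 ≤ YZ) (mTC : YC ≤ YT) :
    0 ≤ (2 - (FZ - FC) / FT) * YZ - FC * HZ - (1 - 0) * YC + ((2 - (1 - F0 / FT)) * YT - F0 * HT - (1 - 0) * Y0) := by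
  have e : (2 - (FZ - FC) / FT) * YZ - FC * HZ - (1 - 0) * YC + ((2 - (1 - F0 / FT)) * YT - F0 * HT - (1 - 0) * Y0) =
      (FC / FZ + (FZ - FC) * (1 / FZ - 1 / FT)) * (YZ - FZ * HZ) + (FZ - FC) * (1 / FZ - 1 / FT) * (FZ * HZ)
        + F0 / FT * (YT - FT * HT) + (YZ - Y0) + (YT - YC) := by
    field_simp; ring
  rw [e]
  have k0 : 0 ≤ (FZ - FC) * (1 / FZ - 1 / FT) :=
    mul_nonneg (sub_nonneg.2 hCZ) (sub_nonneg.2 (one_div_le_one_div_of_le hFZ hZT))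
  have := mul_nonneg (add_nonneg (div_nonneg hC0 hFZ.le) k0) (sub_nonneg.2 sZ)
  have := mul_nonneg k0 (mul_nonneg hFZ.le hHZ); have := mul_nonneg (div_nonneg hF0 hFT.le) (sub_nonneg.2 sT)
  linarith

/-- Rule B2, pattern `{Z,T}`, degenerate sub-case `F_Z = 0` (then `F_0 = F_C = 0` and `ρ_Z = 0`). -/
theorem t2patZT_B2_zero (hFT : 0 < FT) (hY0 : 0 ≤ Y0) (mZ0 : Y0 ≤ YZ) (mTC : YC ≤ YT) :
    0 ≤ (2 - (0 - 0) / FT) * YZ - 0 * HZ - (1 - 0) * YC + ((2 - (1 - 0 / FT)) * YT - 0 * HT - (1 - 0) * Y0) := by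
  have e : (2 - (0 - 0) / FT) * YZ - 0 * HZ - (1 - 0) * YC + ((2 - (1 - 0 / FT)) * YT - 0 * HT - (1 - 0) * Y0) =
      2 * YZ - YC + YT - Y0 := by field_simp; ring
  rw [e]; linarith

/-- Rule B2, pattern `{C,T}`. -/
theorem t2patCT_B2 (hFT : 0 < FT) (hF0 : 0 ≤ F0) (hCZ : FC ≤ FZ) (hgap : FZ - FC ≤ FT) (hTC : HC ≤ HT)
    (sC : FC * HC ≤ YC) (sT : FT * HT ≤ YT) (mC0 : Y0 ≤ YC) (mTZ : YZ ≤ YT) :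
    0 ≤ (2 - 0) * YC - FZ * HC - (1 - (FZ - FC) / FT) * YZ + ((2 - (1 - F0 / FT)) * YT - F0 * HT - (1 - 0) * Y0) := by
  have e : (2 - 0) * YC - FZ * HC - (1 - (FZ - FC) / FT) * YZ + ((2 - (1 - F0 / FT)) * YT - F0 * HT - (1 - 0) * Y0) =
      (YC - FC * HC) + (F0 + FZ - FC) / FT * (YT - FT * HT) + (YC - Y0) + (1 - (FZ - FC) / FT) * (YT - YZ)
        + (FZ - FC) * (HT - HC) := by
    field_simp; ring
  rw [e]
  have c1 : 0 ≤ (F0 + FZ - FC) / FT := div_nonneg (by linarith) hFT.le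
  have c2 : 0 ≤ 1 - (FZ - FC) / FT := by rw [sub_nonneg, div_le_one hFT]; exact hgap
  have := mul_nonneg c1 (sub_nonneg.2 sT); have := mul_nonneg c2 (sub_nonneg.2 mTZ)
  have := mul_nonneg (sub_nonneg.2 hCZ) (sub_nonneg.2 hTC)
  linarith

/-- Edge `{lo, hi}` under the one-dimensional rule `σ = (0, 1 − F_lo/F_hi)`, pattern `{hi}`. -/
theorem t2edge_hi {Flo Fhi Ylo Yhi Hhi : ℝ} (hF : 0 < Fhi) (hlo : 0 ≤ Flo) (s : Fhi * Hhi ≤ Yhi) (m : Ylo ≤ Yhi) :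
    0 ≤ (2 - (1 - Flo / Fhi)) * Yhi - Flo * Hhi - (1 - 0) * Ylo := by
  have e : (2 - (1 - Flo / Fhi)) * Yhi - Flo * Hhi - (1 - 0) * Ylo = (Yhi - Ylo) + Flo / Fhi * (Yhi - Fhi * Hhi) := by
    field_simp; ring
  rw [e]; have := mul_nonneg (div_nonneg hlo hF.le) (sub_nonneg.2 s); linarith

/-- Edge `{lo, hi}` under `σ = (0, 1 − F_lo/F_hi)`, pattern `{lo, hi}`. -/
theorem t2edge_both {Flo Fhi Ylo Yhi Hlo Hhi : ℝ} (hF : 0 < Fhi) (hlh : Flo ≤ Fhi) (hH : Hlo ≤ Hhi)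
    (slo : Flo * Hlo ≤ Ylo) (shi : Fhi * Hhi ≤ Yhi) :
    0 ≤ (2 - (1 - Flo / Fhi)) * Yhi - Flo * Hhi - (1 - 0) * Ylo + ((2 - 0) * Ylo - Fhi * Hlo - (1 - (1 - Flo / Fhi)) * Yhi) := by
  have e : (2 - (1 - Flo / Fhi)) * Yhi - Flo * Hhi - (1 - 0) * Ylo + ((2 - 0) * Ylo - Fhi * Hlo - (1 - (1 - Flo / Fhi)) * Yhi) =
      (Yhi - Fhi * Hhi) + (Ylo - Flo * Hlo) + (Fhi - Flo) * (Hhi - Hlo) := by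
    field_simp; ring
  rw [e]; have := mul_nonneg (sub_nonneg.2 hlh) (sub_nonneg.2 hH); linarith

end Patterns

end SahiT2Square

end Summit.CriticalPhenomena.PercolationContinuityZ3.Theorems
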